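import Literature.MathematicalPhysics.QuantumLattice.SpectralCorrelationInequalities
import Literature.MathematicalPhysics.QuantumLattice.TorusGibbsBogoliubovRow
import HarnessLib

/-!
# KMS-moment rows for canonical Gibbs eigen-mixtures: full space, invariant coordinate sector, translated mixtures

Companion of `SpectralCorrelationInequalities.lean` (the master spectral inequality
`Matrix.IsHermitian.kmsMomentRow_nonneg`: for a Gibbs state, any word `a` and any exponential polynomial
`P(x) = Σ_{k≤K}(pₖ + qₖe^{-βx})x^k ≥ 0` on `ℝ`, `0 ≤ Σₖ (pₖ Re⟨aᴴ ad_H^k a⟩_β + qₖ Re⟨(ad_H^k a)aᴴ⟩_β)`) and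
of `GibbsBogoliubovRow.lean` / `TorusGibbsBogoliubovRow.lean` (the same packaging for the Bogoliubov
rows). This file rewrites the KMS-moment rows in the EIGEN-MIXTURE format consumed by the torus-limit
readers of the Hubbard `T > 0` certificate family (hubbard-thermal THERMAL-SOURCES §2k):

* §1 (full space) `sum_range_kmsMoment_eigenMixture_nonneg`: for `H` Hermitian with Mathlib eigenbasis
  `v_s` and eigenvalues `E_s`, every word `a`, every order `K` and coefficients `p q` with `P ≥ 0` on `ℝ`:
  `0 ≤ Σ_{k≤K} (pₖ · Σ_s e^{-βE_s} Re⟨v_s, aᴴ(ad_H^k a) v_s⟩ + qₖ · Σ_s e^{-βE_s} Re⟨v_s, (ad_H^k a)aᴴ v_s⟩)`;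
* §2 (coordinate sector `p`: `A` Hermitian with no entries between `p` and its complement, `a`, `aᴴ`
  mapping the sector into itself, canonical weights of the compression)
  `sum_range_kmsMoment_sectorMixture_nonneg` — the same rows for the canonical sector Gibbs state
  `tr(P_p e^{-βA} ·)/Z_p` (compress: `(ad_A^k a)|_p = ad_{A|_p}^k (a|_p)`, private `submatrix_adPow`);
* §3 (covariance) `Matrix.conjTranspose_mul_adPow_mul_of_commute` (`Uᴴ (ad_A^k a) U = ad_A^k (UᴴaU)` for `U`
  unitary commuting with `A`) and the rows for unitarily translated sector mixtures `(w_s, Uψ_s)`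
  (`sum_range_kmsMoment_sectorMixture_mulVec_nonneg`);
* §4 (the `t–t'` Hubbard torus) `sum_range_kmsMoment_sectorGibbsTT'_fockTranslate_nonneg`: the rows
  for the translated canonical Gibbs data `(p_{L,i}, U_vψ_{L,i})` of `hubbardTorusTT' L t t' U` on the
  sector `(rectN n L, S^z = 0)`, for every torus word `a` commuting with `N` and `S^z`.

Everything is PROVED; no definition beyond dot-notation lemmas on `Matrix.adPow`; no named fact.
The torus-limit transport (footprint rule `thicken(supp a, k) ⊆ Λ'`) is not included here.

## References

* C. Itoi, H. Ishimori, K. Sato, Y. Sakamoto, J. Phys. Soc. Jpn. 92 (2023) 074001 = arXiv:2306.03489,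
  §3 (spectral representation; the fixed-test-function members Thms 1–4) [ItoiEtAl2023].
* H. Fawzi, O. Fawzi, S. O. Scalet, Nat. Commun. 15 (2024) 7394, Thm 3.1 (the degree-(1,0) members = EEB)
  [FawziFawziScalet2024].

## Mathlib / tree search

REUSED: `Matrix.IsHermitian.kmsMomentRow_nonneg`, `Matrix.adPow` (`SpectralCorrelationInequalities`);
`trace_gibbsWeight_mul_eq_sum` (`GibbsTwoTimeBound`), `Matrix.IsHermitian.re_gibbsState`
(`DuhamelTwoPoint`); `sectorExtend`, `sectorEigenvector`, `sectorEigenvalue`, `canonicalWeight`,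
`sectorGibbs*TT'`, `sectorGibbsIndex`, `hubbardTorusTT'_apply_eq_zero_of_szConfig`
(`TorusSectorGibbsMixture`); `mul_apply_eq_zero_off` (`GibbsEnergyEntropyBalance`);
`star_mulVec_dotProduct_mulVec_mulVec` (`CompressedFormOnSector`); `fockTranslate_*`,
`apply_eq_zero_of_szConfig_of_commute`, `conjTranspose_apply_eq_zero_of_szConfig_of_commute`
(`TorusGibbsEnergyEntropyBalance`); `fockTranslate_commute_hubbardTorusTT'`. The sector-compression
plumbing is private in `GibbsBogoliubovRow.lean` and re-proved here privately (same statements).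
-/

noncomputable section

namespace Matrix

variable {ι : Type*} [Fintype ι]

/-- `ad_A^k` commutes with unitary conjugation by a `U` commuting with `A`:
`Uᴴ (ad_A^k a) U = ad_A^k (Uᴴ a U)`. [cite: ItoiEtAl2023, §2 eq. (C_A^k)] -/
theorem conjTranspose_mul_adPow_mul_of_commute {U A : Matrix ι ι ℂ}
    (hU : ∀ X : Matrix ι ι ℂ, Uᴴ * (U * X) = X) (hU' : ∀ X : Matrix ι ι ℂ, U * (Uᴴ * X) = X)
    (hUA : Commute U A) (a : Matrix ι ι ℂ) (k : ℕ) :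
    Uᴴ * adPow A k a * U = adPow A k (Uᴴ * a * U) := by
  have hconj : ∀ Y Z : Matrix ι ι ℂ, Uᴴ * (Y * Z) * U = (Uᴴ * Y * U) * (Uᴴ * Z * U) := by
    intro Y Z
    calc Uᴴ * (Y * Z) * U = Uᴴ * Y * (Z * U) := by simp only [Matrix.mul_assoc]
      _ = Uᴴ * Y * (U * (Uᴴ * (Z * U))) := by rw [hU']
      _ = (Uᴴ * Y * U) * (Uᴴ * Z * U) := by simp only [Matrix.mul_assoc]
  have hA : Uᴴ * A * U = A := by
    rw [Matrix.mul_assoc, ← hUA.eq, hU]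
  induction k with
  | zero => simp
  | succ k ih =>
    rw [adPow_succ, adPow_succ, Matrix.mul_sub, Matrix.sub_mul, hconj, hconj, hA, ih]

variable (p : ι → Prop) [DecidablePred p]

/-- `ad_A^k a` maps the sector into itself when `A` and `a` do. [folklore] -/
private theorem adPow_apply_eq_zero_off {A a : Matrix ι ι ℂ} (hA : ∀ i j, ¬ p i → p j → A i j = 0)
    (ha : ∀ i j, ¬ p i → p j → a i j = 0) (k : ℕ) :
    ∀ i j, ¬ p i → p j → adPow A k a i j = 0 := by
  induction k with
  | zero => simpa using ha
  | succ k ih =>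
    intro i j hi hj
    rw [adPow_succ, sub_apply,
      Literature.MathematicalPhysics.QuantumLattice.mul_apply_eq_zero_off p hA ih i j hi hj,
      Literature.MathematicalPhysics.QuantumLattice.mul_apply_eq_zero_off p ih hA i j hi hj, sub_zero]

/-- A sum over all coordinates of a function vanishing off the sector is the sum over the sector.
[folklore] -/
private theorem sum_eq_sum_subtype_of_eq_zero_off_kms (f : ι → ℂ) (hf : ∀ i, ¬ p i → f i = 0) :
    ∑ i, f i = ∑ a : Subtype p, f a.1 := by
  rw [← Finset.sum_subtype (Finset.univ.filter p) (by simp), Finset.sum_filter_of_ne]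
  intro i _ hi
  by_contra h
  exact hi (hf i h)

/-- If the right factor maps the sector into itself, compression is multiplicative:
`(M N)|_p = M|_p N|_p`. [folklore] -/
private theorem submatrix_mul_of_apply_eq_zero_off_kms (M N : Matrix ι ι ℂ)
    (hN : ∀ i j, ¬ p i → p j → N i j = 0) :
    (M * N).submatrix (Subtype.val : Subtype p → ι) (Subtype.val : Subtype p → ι) =
      M.submatrix (Subtype.val : Subtype p → ι) (Subtype.val : Subtype p → ι) *
        N.submatrix (Subtype.val : Subtype p → ι) (Subtype.val : Subtype p → ι) := by
  ext a b
  rw [Matrix.submatrix_apply, Matrix.mul_apply, Matrix.mul_apply,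
    sum_eq_sum_subtype_of_eq_zero_off_kms p]
  · rfl
  · intro k hk
    rw [hN k b.1 hk b.2, mul_zero]

/-- **Compression commutes with `ad^k`**: `(ad_A^k a)|_p = ad_{A|_p}^k (a|_p)` when `A` and `a` map the
sector into itself. [folklore] -/
private theorem submatrix_adPow {A a : Matrix ι ι ℂ} (hA : ∀ i j, ¬ p i → p j → A i j = 0)
    (ha : ∀ i j, ¬ p i → p j → a i j = 0) (k : ℕ) :
    (adPow A k a).submatrix (Subtype.val : Subtype p → ι) (Subtype.val : Subtype p → ι) =
      adPow (A.submatrix (Subtype.val : Subtype p → ι) Subtype.val) k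
        (a.submatrix (Subtype.val : Subtype p → ι) Subtype.val) := by
  induction k with
  | zero => simp
  | succ k ih =>
    rw [adPow_succ, adPow_succ, Matrix.submatrix_sub, Pi.sub_apply, Pi.sub_apply,
      submatrix_mul_of_apply_eq_zero_off_kms p A _ (adPow_apply_eq_zero_off p hA ha k),
      submatrix_mul_of_apply_eq_zero_off_kms p _ A hA, ih]

end Matrix

namespace Literature.MathematicalPhysics.QuantumLattice

open Matrix Finset HubbardWave0 Literature.Probability.LatticeModels
open scoped ComplexOrder BigOperators

/-! ### §1 Full space -/

section FullSpace

variable {κ : Type*} [Fintype κ] [DecidableEq κ]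

omit [DecidableEq κ] in
/-- A diagonal entry of `Vᴴ X V` is the expectation of `X` in the corresponding column of `V`.
[folklore] -/
private theorem conjTranspose_mul_mul_apply_same_kms (V X : Matrix κ κ ℂ) (a : κ) :
    (Vᴴ * X * V) a a = star (fun i => V i a) ⬝ᵥ (X *ᵥ fun i => V i a) := by
  rw [Matrix.mul_assoc, Matrix.mul_apply]
  simp only [conjTranspose_apply, dotProduct, Pi.star_apply, mulVec, Matrix.mul_apply]

/-- **Real part of a Gibbs expectation as an eigen-mixture**:
`Re⟨X⟩_β = Z⁻¹ Σ_s e^{−βE_s} Re⟨v_s, X v_s⟩`. [folklore] -/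
private theorem re_gibbsState_eq_sum_eigenvector_kms {H : Matrix κ κ ℂ} (hH : H.IsHermitian) (β : ℝ)
    (X : Matrix κ κ ℂ) :
    (gibbsState β H X).re = (∑ a, Real.exp (-(β * hH.eigenvalues a)))⁻¹ *
      ∑ a, Real.exp (-(β * hH.eigenvalues a)) *
        (star (fun i => (hH.eigenvectorUnitary : Matrix κ κ ℂ) i a) ⬝ᵥ
          (X *ᵥ fun i => (hH.eigenvectorUnitary : Matrix κ κ ℂ) i a)).re := by
  rw [hH.re_gibbsState β X, trace_gibbsWeight_mul_eq_sum hH β X, Complex.re_sum]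
  refine congrArg (fun t => (∑ a, Real.exp (-(β * hH.eigenvalues a)))⁻¹ * t) ?_
  refine sum_congr rfl fun a _ => ?_
  rw [Matrix.star_eq_conjTranspose, conjTranspose_mul_mul_apply_same_kms, Complex.re_ofReal_mul,
    neg_mul]

/-- **KMS-moment rows for the canonical eigen-mixture of a Hermitian matrix (Boltzmann weights,
unnormalised).** For `H` Hermitian with orthonormal eigenbasis `v_s` (columns of
`Matrix.IsHermitian.eigenvectorUnitary`) and eigenvalues `E_s`, EVERY real `β`, every word `a`, every
order `K` and coefficients `p q : ℕ → ℝ` whose exponential polynomial `Σ_{k≤K}(pₖ + qₖe^{-βx})x^k` is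
nonnegative on `ℝ`:
`0 ≤ Σ_{k≤K} (pₖ · Σ_s e^{−βE_s} Re⟨v_s, aᴴ(ad_H^k a) v_s⟩ + qₖ · Σ_s e^{−βE_s} Re⟨v_s, (ad_H^k a)aᴴ v_s⟩)`
— `Z` times `Matrix.IsHermitian.kmsMomentRow_nonneg`. [cite: ItoiEtAl2023, §3 Lemmas 1–5 and proof of Thm 3] -/
theorem sum_range_kmsMoment_eigenMixture_nonneg {H : Matrix κ κ ℂ} (hH : H.IsHermitian) (β : ℝ)
    (a : Matrix κ κ ℂ) (K : ℕ) (p q : ℕ → ℝ)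
    (hP : ∀ x : ℝ, 0 ≤ ∑ k ∈ Finset.range (K + 1), (p k + q k * Real.exp (-(β * x))) * x ^ k) :
    0 ≤ ∑ k ∈ Finset.range (K + 1),
      (p k * ∑ s, Real.exp (-(β * hH.eigenvalues s)) *
          (star (fun i => (hH.eigenvectorUnitary : Matrix κ κ ℂ) i s) ⬝ᵥ
            ((aᴴ * adPow H k a) *ᵥ fun i => (hH.eigenvectorUnitary : Matrix κ κ ℂ) i s)).re +
        q k * ∑ s, Real.exp (-(β * hH.eigenvalues s)) *
          (star (fun i => (hH.eigenvectorUnitary : Matrix κ κ ℂ) i s) ⬝ᵥ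
            ((adPow H k a * aᴴ) *ᵥ fun i => (hH.eigenvectorUnitary : Matrix κ κ ℂ) i s)).re) := by
  rcases isEmpty_or_nonempty κ with hκ | hκ
  · simp
  set Z : ℝ := ∑ s, Real.exp (-(β * hH.eigenvalues s)) with hZdef
  have hZ : 0 < Z := Finset.sum_pos (fun _ _ => Real.exp_pos _) Finset.univ_nonempty
  have hrow := hH.kmsMomentRow_nonneg β a K p q hP
  -- `Re⟨X⟩ = Z⁻¹ · (mixture sum)`, so each mixture sum is `Z · Re⟨X⟩`
  have hmix : ∀ X : Matrix κ κ ℂ, ∑ s, Real.exp (-(β * hH.eigenvalues s)) *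
      (star (fun i => (hH.eigenvectorUnitary : Matrix κ κ ℂ) i s) ⬝ᵥ
        (X *ᵥ fun i => (hH.eigenvectorUnitary : Matrix κ κ ℂ) i s)).re = Z * (gibbsState β H X).re := by
    intro X
    rw [re_gibbsState_eq_sum_eigenvector_kms hH β X, ← hZdef, ← mul_assoc, mul_inv_cancel₀ hZ.ne',
      one_mul]
  refine (mul_nonneg hZ.le hrow).trans_eq ?_
  rw [Finset.mul_sum]
  refine sum_congr rfl fun k _ => ?_
  rw [hmix, hmix]
  ring

end FullSpace

/-! ### §2 The canonical eigen-mixture of a Hermitian matrix compressed to an invariant coordinate sector -/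

section CoordinateSector

variable {ι : Type*} [Fintype ι] [DecidableEq ι] (p : ι → Prop) [DecidablePred p]

omit [DecidableEq ι] in
/-- A sum over all coordinates of a function vanishing off the sector is the sum over the sector.
[folklore] -/
private theorem sum_eq_sum_subtype_of_eq_zero_off_kms' (f : ι → ℂ) (hf : ∀ i, ¬ p i → f i = 0) :
    ∑ i, f i = ∑ a : Subtype p, f a.1 := by
  rw [← Finset.sum_subtype (Finset.univ.filter p) (by simp), Finset.sum_filter_of_ne]
  intro i _ hi
  by_contra h
  exact hi (hf i h)

omit [DecidableEq ι] in
/-- **Expectations in an extended sector vector only see the compression**: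
`⟨ext φ, X ext φ⟩ = ⟨φ, X|_p φ⟩` for EVERY matrix `X`. [folklore] -/
private theorem star_sectorExtend_dotProduct_mulVec_sectorExtend_kms (X : Matrix ι ι ℂ)
    (φ : Subtype p → ℂ) :
    star (sectorExtend p φ) ⬝ᵥ (X *ᵥ sectorExtend p φ) =
      star φ ⬝ᵥ (X.submatrix (Subtype.val : Subtype p → ι) Subtype.val *ᵥ φ) := by
  have hext : ∀ a : Subtype p, sectorExtend p φ a.1 = φ a := fun a => by simp [sectorExtend, a.2]
  have hoff : ∀ i, ¬ p i → sectorExtend p φ i = 0 := fun i hi => by simp [sectorExtend, hi]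
  rw [dotProduct, dotProduct, sum_eq_sum_subtype_of_eq_zero_off_kms' p]
  · refine Finset.sum_congr rfl fun a _ => ?_
    rw [Pi.star_apply, Pi.star_apply, hext, mulVec, mulVec, dotProduct, dotProduct,
      sum_eq_sum_subtype_of_eq_zero_off_kms' p]
    · simp only [Matrix.submatrix_apply, hext]
    · intro j hj
      rw [hoff j hj, mul_zero]
  · intro i hi
    rw [Pi.star_apply, hoff i hi, star_zero, zero_mul]

omit [DecidableEq ι] in
/-- Compression is multiplicative when the right factor preserves the sector. [folklore] -/
private theorem submatrix_mul_of_apply_eq_zero_off_kms' (M N : Matrix ι ι ℂ)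
    (hN : ∀ i j, ¬ p i → p j → N i j = 0) :
    (M * N).submatrix (Subtype.val : Subtype p → ι) (Subtype.val : Subtype p → ι) =
      M.submatrix (Subtype.val : Subtype p → ι) (Subtype.val : Subtype p → ι) *
        N.submatrix (Subtype.val : Subtype p → ι) (Subtype.val : Subtype p → ι) := by
  ext a b
  rw [Matrix.submatrix_apply, Matrix.mul_apply, Matrix.mul_apply,
    sum_eq_sum_subtype_of_eq_zero_off_kms' p]
  · rfl
  · intro k hk
    rw [hN k b.1 hk b.2, mul_zero]

/-- **KMS-moment rows for the canonical sector Gibbs eigen-mixture.** Let `A` be Hermitian with no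
entries between the coordinate sector `p` and its complement, `ψ_s` (`sectorEigenvector`) the extended
orthonormal eigenbasis of the compression with eigenvalues `E_s` (`sectorEigenvalue`) and canonical
weights `w_s = e^{−βE_s}/Z` (`canonicalWeight`). For every word `a` such that `a` and `aᴴ` map the sector
into itself, every real `β`, order `K` and coefficients `p q` with `Σ_{k≤K}(pₖ + qₖe^{-βx})x^k ≥ 0` on `ℝ`:
`0 ≤ Σ_{k≤K} (pₖ · Σ_s w_s Re⟨ψ_s, aᴴ(ad_A^k a) ψ_s⟩ + qₖ · Σ_s w_s Re⟨ψ_s, (ad_A^k a)aᴴ ψ_s⟩)`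
(compress to the sector — `(ad_A^k a)|_p = ad_{A|_p}^k (a|_p)` — and apply `sum_range_kmsMoment_eigenMixture_nonneg`:
the canonical sector state is the Gibbs state of the compressed Hamiltonian).
[cite: ItoiEtAl2023, §3 Lemmas 1–5 and proof of Thm 3] -/
theorem sum_range_kmsMoment_sectorMixture_nonneg {A : Matrix ι ι ℂ} (hA : A.IsHermitian)
    (hinv : ∀ i j, ¬ p i → p j → A i j = 0) {a : Matrix ι ι ℂ}
    (ha : ∀ i j, ¬ p i → p j → a i j = 0) (ha' : ∀ i j, ¬ p i → p j → aᴴ i j = 0)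
    (β : ℝ) (K : ℕ) (cp cq : ℕ → ℝ)
    (hP : ∀ x : ℝ, 0 ≤ ∑ k ∈ Finset.range (K + 1), (cp k + cq k * Real.exp (-(β * x))) * x ^ k) :
    0 ≤ ∑ k ∈ Finset.range (K + 1),
      (cp k * ∑ s, canonicalWeight β (sectorEigenvalue p A hA) s *
          (star (sectorEigenvector p A hA s) ⬝ᵥ ((aᴴ * adPow A k a) *ᵥ sectorEigenvector p A hA s)).re +
        cq k * ∑ s, canonicalWeight β (sectorEigenvalue p A hA) s *
          (star (sectorEigenvector p A hA s) ⬝ᵥ ((adPow A k a * aᴴ) *ᵥ sectorEigenvector p A hA s)).re) := by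
  set hAp := hA.submatrix (Subtype.val : Subtype p → ι) with hApdef
  set Ap : Matrix (Subtype p) (Subtype p) ℂ := A.submatrix (Subtype.val : Subtype p → ι) Subtype.val
    with hAp'
  set ap : Matrix (Subtype p) (Subtype p) ℂ := a.submatrix (Subtype.val : Subtype p → ι) Subtype.val
    with hap
  have hat : (aᴴ).submatrix (Subtype.val : Subtype p → ι) Subtype.val = apᴴ := by
    rw [hap, Matrix.conjTranspose_submatrix]
  -- compressions of the two words
  have hw1 : ∀ k, (aᴴ * adPow A k a).submatrix (Subtype.val : Subtype p → ι) Subtype.val =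
      apᴴ * adPow Ap k ap := fun k => by
    rw [submatrix_mul_of_apply_eq_zero_off_kms' p _ _ (adPow_apply_eq_zero_off p hinv ha k), hat,
      Matrix.submatrix_adPow p hinv ha k]
  have hw2 : ∀ k, (adPow A k a * aᴴ).submatrix (Subtype.val : Subtype p → ι) Subtype.val =
      adPow Ap k ap * apᴴ := fun k => by
    rw [submatrix_mul_of_apply_eq_zero_off_kms' p _ _ ha', hat, Matrix.submatrix_adPow p hinv ha k]
  have hterm1 : ∀ k (s : Subtype p),
      star (sectorEigenvector p A hA s) ⬝ᵥ ((aᴴ * adPow A k a) *ᵥ sectorEigenvector p A hA s) =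
      star (fun b => (hAp.eigenvectorUnitary : Matrix (Subtype p) (Subtype p) ℂ) b s) ⬝ᵥ
        ((apᴴ * adPow Ap k ap) *ᵥ fun b => (hAp.eigenvectorUnitary : Matrix (Subtype p) (Subtype p) ℂ) b s) := by
    intro k s
    rw [sectorEigenvector, star_sectorExtend_dotProduct_mulVec_sectorExtend_kms, hw1]
  have hterm2 : ∀ k (s : Subtype p),
      star (sectorEigenvector p A hA s) ⬝ᵥ ((adPow A k a * aᴴ) *ᵥ sectorEigenvector p A hA s) =
      star (fun b => (hAp.eigenvectorUnitary : Matrix (Subtype p) (Subtype p) ℂ) b s) ⬝ᵥ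
        ((adPow Ap k ap * apᴴ) *ᵥ fun b => (hAp.eigenvectorUnitary : Matrix (Subtype p) (Subtype p) ℂ) b s) := by
    intro k s
    rw [sectorEigenvector, star_sectorExtend_dotProduct_mulVec_sectorExtend_kms, hw2]
  have hw : ∀ s : Subtype p, canonicalWeight β (sectorEigenvalue p A hA) s =
      (∑ b, Real.exp (-(β * hAp.eigenvalues b)))⁻¹ * Real.exp (-(β * hAp.eigenvalues s)) :=
    fun s => rfl
  have hZ : 0 ≤ (∑ b, Real.exp (-(β * hAp.eigenvalues b)))⁻¹ :=
    inv_nonneg.2 (Finset.sum_nonneg fun _ _ => (Real.exp_pos _).le)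
  have key := sum_range_kmsMoment_eigenMixture_nonneg hAp β ap K cp cq hP
  refine (mul_nonneg hZ key).trans_eq ?_
  rw [Finset.mul_sum]
  refine sum_congr rfl fun k _ => ?_
  simp_rw [hterm1, hterm2, hw, mul_assoc, ← Finset.mul_sum]
  ring

/-! ### §3 Covariance: unitarily translated sector mixtures -/

/-- **KMS-moment rows for unitarily transformed canonical sector eigen-mixtures.** Under the hypotheses
of `sum_range_kmsMoment_sectorMixture_nonneg`, if moreover `U` is unitary, commutes with `A`, and `U`,
`Uᴴ` map the sector into itself, the mixture `(w_s, Uψ_s)` satisfies the same rows (covariance: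
`Uᴴ aᴴ(ad_A^k a) U = bᴴ(ad_A^k b)`, `b = UᴴaU`, `Matrix.conjTranspose_mul_adPow_mul_of_commute`).
[cite: ItoiEtAl2023, §3 Lemmas 1–5 and proof of Thm 3] -/
theorem sum_range_kmsMoment_sectorMixture_mulVec_nonneg {A : Matrix ι ι ℂ} (hA : A.IsHermitian)
    (hinv : ∀ i j, ¬ p i → p j → A i j = 0) {U : Matrix ι ι ℂ}
    (hU : ∀ X : Matrix ι ι ℂ, Uᴴ * (U * X) = X) (hU' : ∀ X : Matrix ι ι ℂ, U * (Uᴴ * X) = X)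
    (hUA : Commute U A) (hUp : ∀ i j, ¬ p i → p j → U i j = 0) (hUp' : ∀ i j, ¬ p i → p j → Uᴴ i j = 0)
    {a : Matrix ι ι ℂ} (ha : ∀ i j, ¬ p i → p j → a i j = 0) (ha' : ∀ i j, ¬ p i → p j → aᴴ i j = 0)
    (β : ℝ) (K : ℕ) (cp cq : ℕ → ℝ)
    (hP : ∀ x : ℝ, 0 ≤ ∑ k ∈ Finset.range (K + 1), (cp k + cq k * Real.exp (-(β * x))) * x ^ k) :
    0 ≤ ∑ k ∈ Finset.range (K + 1),
      (cp k * ∑ s, canonicalWeight β (sectorEigenvalue p A hA) s *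
          (star (U *ᵥ sectorEigenvector p A hA s) ⬝ᵥ
            ((aᴴ * adPow A k a) *ᵥ (U *ᵥ sectorEigenvector p A hA s))).re +
        cq k * ∑ s, canonicalWeight β (sectorEigenvalue p A hA) s *
          (star (U *ᵥ sectorEigenvector p A hA s) ⬝ᵥ
            ((adPow A k a * aᴴ) *ᵥ (U *ᵥ sectorEigenvector p A hA s))).re) := by
  set b : Matrix ι ι ℂ := Uᴴ * a * U with hb
  have hbt : bᴴ = Uᴴ * aᴴ * U := by
    rw [hb, conjTranspose_mul, conjTranspose_mul, conjTranspose_conjTranspose, Matrix.mul_assoc]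
  have hb₁ : ∀ i j, ¬ p i → p j → b i j = 0 :=
    mul_apply_eq_zero_off p (mul_apply_eq_zero_off p hUp' ha) hUp
  have hb₂ : ∀ i j, ¬ p i → p j → bᴴ i j = 0 := by
    rw [hbt]
    exact mul_apply_eq_zero_off p (mul_apply_eq_zero_off p hUp' ha') hUp
  have hconj : ∀ Y Z : Matrix ι ι ℂ, Uᴴ * (Y * Z) * U = (Uᴴ * Y * U) * (Uᴴ * Z * U) := by
    intro Y Z
    calc Uᴴ * (Y * Z) * U = Uᴴ * Y * (Z * U) := by simp only [Matrix.mul_assoc]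
      _ = Uᴴ * Y * (U * (Uᴴ * (Z * U))) := by rw [hU']
      _ = (Uᴴ * Y * U) * (Uᴴ * Z * U) := by simp only [Matrix.mul_assoc]
  have hcov1 : ∀ k, Uᴴ * (aᴴ * adPow A k a) * U = bᴴ * adPow A k b := fun k => by
    rw [hconj, conjTranspose_mul_adPow_mul_of_commute hU hU' hUA, hbt, hb]
  have hcov2 : ∀ k, Uᴴ * (adPow A k a * aᴴ) * U = adPow A k b * bᴴ := fun k => by
    rw [hconj, conjTranspose_mul_adPow_mul_of_commute hU hU' hUA, hbt, hb]
  have h1 : ∀ k s, star (U *ᵥ sectorEigenvector p A hA s) ⬝ᵥ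
      ((aᴴ * adPow A k a) *ᵥ (U *ᵥ sectorEigenvector p A hA s)) =
      star (sectorEigenvector p A hA s) ⬝ᵥ ((bᴴ * adPow A k b) *ᵥ sectorEigenvector p A hA s) := by
    intro k s
    rw [star_mulVec_dotProduct_mulVec_mulVec U _ _ _, hcov1]
  have h2 : ∀ k s, star (U *ᵥ sectorEigenvector p A hA s) ⬝ᵥ
      ((adPow A k a * aᴴ) *ᵥ (U *ᵥ sectorEigenvector p A hA s)) =
      star (sectorEigenvector p A hA s) ⬝ᵥ ((adPow A k b * bᴴ) *ᵥ sectorEigenvector p A hA s) := by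
    intro k s
    rw [star_mulVec_dotProduct_mulVec_mulVec U _ _ _, hcov2]
  simp_rw [h1, h2]
  exact sum_range_kmsMoment_sectorMixture_nonneg p hA hinv hb₁ hb₂ β K cp cq hP

end CoordinateSector

/-! ### §4 The canonical sector Gibbs state of the `t–t'` torus: the rows in the translated eigen-mixtures -/

section Torus

variable (L : ℕ)

/-- Canonical weights are invariant under reindexing the family of energies. [folklore] -/
private theorem canonicalWeight_comp_equiv_kms {κ κ' : Type*} [Fintype κ] [Fintype κ'] (e : κ' ≃ κ)
    (β : ℝ) (E : κ → ℝ) (a : κ') :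
    canonicalWeight β (E ∘ e) a = canonicalWeight β E (e a) := by
  unfold canonicalWeight
  rw [show (∑ b, Real.exp (-(β * (E ∘ e) b))) = ∑ b, Real.exp (-(β * E b)) from
    Equiv.sum_comp e (fun b => Real.exp (-(β * E b)))]
  rfl

variable [NeZero L]

/-- **KMS-moment rows for the translated canonical Gibbs mixtures of the `t–t'` torus.** For
`H_L = hubbardTorusTT' L t t' U`, the canonical Gibbs data `(p_{L,i}, ψ_{L,i})` of the sector
`(rectN n L, S^z = 0)` at ANY real `β`, a translation `v`, every torus word `a` commuting with `N` and
`S^z`, every order `K` and coefficients `p q` whose exponential polynomial is nonnegative on `ℝ`: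
`0 ≤ Σ_{k≤K} (pₖ · Σ_i p_{L,i} Re⟨U_vψ_{L,i}, aᴴ(ad_{H_L}^k a) U_vψ_{L,i}⟩ + qₖ · Σ_i p_{L,i} Re⟨U_vψ_{L,i}, (ad_{H_L}^k a)aᴴ U_vψ_{L,i}⟩)`
(`sum_range_kmsMoment_sectorMixture_mulVec_nonneg`: `U_v` is unitary, commutes with `H_L` and preserves
the sector). No hypothesis on `t, t', U, n`. [cite: ItoiEtAl2023, §3 Lemmas 1–5 and proof of Thm 3] -/
theorem sum_range_kmsMoment_sectorGibbsTT'_fockTranslate_nonneg (t t' U n β : ℝ) (v : TorusSite 2 L)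
    {a : Matrix (Finset (Orb (FermionTorus 2 L))) (Finset (Orb (FermionTorus 2 L))) ℂ}
    (haN : Commute a totalNumber) (haS : Commute a HubbardWave0.spinZ) (K : ℕ) (cp cq : ℕ → ℝ)
    (hP : ∀ x : ℝ, 0 ≤ ∑ k ∈ Finset.range (K + 1), (cp k + cq k * Real.exp (-(β * x))) * x ^ k) :
    0 ≤ ∑ k ∈ Finset.range (K + 1),
      (cp k * ∑ i, sectorGibbsWeightTT' β t t' U n L i *
          (star ((fockTranslate v).val *ᵥ sectorGibbsVectorTT' t t' U n L i) ⬝ᵥ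
            ((aᴴ * adPow (hubbardTorusTT' L t t' U) k a) *ᵥ
              ((fockTranslate v).val *ᵥ sectorGibbsVectorTT' t t' U n L i))).re +
        cq k * ∑ i, sectorGibbsWeightTT' β t t' U n L i *
          (star ((fockTranslate v).val *ᵥ sectorGibbsVectorTT' t t' U n L i) ⬝ᵥ
            ((adPow (hubbardTorusTT' L t t' U) k a * aᴴ) *ᵥ
              ((fockTranslate v).val *ᵥ sectorGibbsVectorTT' t t' U n L i))).re) := by
  set H := hubbardTorusTT' L t t' U with hH
  have hA : H.IsHermitian := hubbardTorusTT'_isHermitian L t t' U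
  have hinv : ∀ s s', ¬ szConfig n L s → szConfig n L s' → H s s' = 0 :=
    fun s s' hs hs' => hubbardTorusTT'_apply_eq_zero_of_szConfig L t t' U n s s' hs hs'
  have hUp' : ∀ s s', ¬ szConfig n L s → szConfig n L s' → (fockTranslate v).valᴴ s s' = 0 := by
    intro s s' hs hs'
    rw [fockTranslate_val_conjTranspose_eq_neg]
    exact fockTranslate_apply_eq_zero_of_szConfig L (-v) n s s' hs hs'
  have key := sum_range_kmsMoment_sectorMixture_mulVec_nonneg (szConfig n L) hA hinv
    (fockTranslate_val_conjTranspose_mul_val_mul L v) (fockTranslate_val_mul_val_conjTranspose_mul L v)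
    (fockTranslate_commute_hubbardTorusTT' L v t t' U)
    (fun s s' hs hs' => fockTranslate_apply_eq_zero_of_szConfig L v n s s' hs hs') hUp'
    (apply_eq_zero_of_szConfig_of_commute L n haN haS)
    (conjTranspose_apply_eq_zero_of_szConfig_of_commute L n haN haS) β K cp cq hP
  -- transport the mixture sums from `Subtype (szConfig n L)` to `Fin (sectorGibbsCount n L)`
  set e := sectorGibbsIndex n L with he
  have hsum : ∀ (X : Matrix (Finset (Orb (FermionTorus 2 L))) (Finset (Orb (FermionTorus 2 L))) ℂ),
      ∑ s, canonicalWeight β (sectorEigenvalue (szConfig n L) H hA) s *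
        (star ((fockTranslate v).val *ᵥ sectorEigenvector (szConfig n L) H hA s) ⬝ᵥ
          (X *ᵥ ((fockTranslate v).val *ᵥ sectorEigenvector (szConfig n L) H hA s))).re =
      ∑ i, sectorGibbsWeightTT' β t t' U n L i *
        (star ((fockTranslate v).val *ᵥ sectorGibbsVectorTT' t t' U n L i) ⬝ᵥ
          (X *ᵥ ((fockTranslate v).val *ᵥ sectorGibbsVectorTT' t t' U n L i))).re := by
    intro X
    rw [← Equiv.sum_comp e]
    refine Finset.sum_congr rfl fun i _ => ?_
    rw [sectorGibbsWeightTT', show sectorGibbsEnergyTT' t t' U n L =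
      sectorEigenvalue (szConfig n L) H hA ∘ e from rfl, canonicalWeight_comp_equiv_kms]
    rfl
  exact key.trans_eq (Finset.sum_congr rfl fun k _ => by rw [hsum, hsum])

end Torus

end Literature.MathematicalPhysics.QuantumLattice

end
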